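import Literature.Geometry.Symplectic.TaubesFamilyCurvatureComponents
import Literature.Geometry.Symplectic.TaubesCanonicalSolutionStepOne
import Literature.Geometry.Symplectic.SymplecticWedgeSquare
import Literature.Geometry.GaugeTheory.ConnectionDifference
import Literature.Geometry.Manifold.DeRhamOrientationSignFour
import HarnessLib

/-!
# The integrated `ω`-component of the curvature equation of Taubes's `r`-family:
# `∫_N r(1 - |α|² + |β|²) ω ∧ ω = 0`

Topic `Literature/Geometry/Symplectic`; continues `TaubesFamilyCurvatureComponents` (pointwise:
the `ω`-component of `iρ⁺(F_A) = q(ψ) + iρ⁺(η)`, `η = η₀ - (|c|²/4)s`, is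
`(F_A)⁺₀ - (η₀)⁺₀ = (|ψ₁|² - |ψ₀|² - |c|²)/2`), `TaubesCanonicalSolutionStepOne` (Taubes's
perturbation `η₀ = P₊F_{A₀}`), `GaugeTheory/ConnectionDifference` (`F_A = F_{A₀} + da`, `a = A - A₀`
a global 1-form), `SymplecticWedgeSquare` (the `(2,2)` shuffle formula, `s ∧ s` a nowhere-zero
closed top form, the unconditional wedge calculus on `4`-manifolds) and the tree's integration
theory (`MForm.integral`, Stokes `∫_N dβ = 0`, the ray orientation of a nowhere-zero top form,
`Manifold/DeRhamOrientationSignFour`).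

Taubes 1994, §3, Step 1 ((19)–(20), p. 816) and Lemma 4 (p. 815): the `ω`-component of the
curvature equation is integrated over the closed manifold `X`; since `F_A` and `F_{A₀}` are
cohomologous ("If such were the case, then `F_A` and `F_{A₀}` would not be cohomologous, and so `A`
would not be a connection on `K⁻¹`"), `∫_X (F_A - F_{A₀}) ∧ ω = ∫_X da ∧ ω = ∫_X d(a ∧ ω) = 0`
(`dω = 0`), so the `r`-dependent and the quadratic terms of the `ω`-component integrate to zero
against each other.  For the family of the tree (Taubes 1995, (5.2): `P₊F_A = ¼τ(ψ ⊗ ψ*) + P₊F_{A₀}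
- (i/4) r ω`, `r = |c|²`) this is the identity

  **`∫_N (|ψ₁|² - |ψ₀|² - |c|²) · s ∧ s = 0`**, i.e. `r · ∫_N (1 - |α|² + |β|²) ω ∧ ω = 0`

in Taubes's scaling `ψ = √r(α u₀ + β)` (`ψ₁ = √r α` along `u₀`, `ψ₀ = √r β` along `K⁻¹`):
`integral_normSq_sub_smul_wedge_self_eq_zero`.  Together with the pointwise bound
`|α|² + |β|² ≤ 1 + z/r` (`TaubesFamilyPointwiseBound`) it yields the `L²`-smallness of `β` and of
`1 - |α|²` that drives Lemma 6 of Taubes 1994.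

Ingredients proved here: `sdCoeff_sdMatrix` (`(Ω⁺)⁺ₖ = Ω⁺ₖ`); in a unitary frame `e` of `𝔰_J`,
`(θ ∧ s)(e) = θ⁺₀` and `(s ∧ s)(e) = 2` (`wedge_symplectic_apply_frame`,
`wedge_self_symplectic_apply_frame`); top forms on a `4`-space agreeing on one frame are equal
(`ContinuousAlternatingMap.eq_of_apply_frame_eq_four`); hence **`θ ∧ s = (θ⁺₀/2) · (s ∧ s)`** for
every 2-form `θ` (`wedge_symplectic_eq_smul_wedge_self`); `F_A - F_{A₀} = da` is exact, so
`(F_A - F_{A₀}) ∧ s` is exact and integrates to zero (`integral_wedge_curvatureForm_sub_eq_zero`).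

PROVED, 0 named facts.

## References

* C. H. Taubes, *The Seiberg–Witten invariants and symplectic forms*, Math. Res. Lett. 1 (1994)
  809–822, §2 (6), Lemma 4, §3 Step 1 (19)–(20). [Taubes1994]
* C. H. Taubes, *The Seiberg–Witten and Gromov invariants*, Math. Res. Lett. 2 (1995) 221–238,
  §5 (5.2)–(5.3), Step 3. [Taubes1995]
* F. W. Warner, *Foundations of Differentiable Manifolds and Lie Groups*, GTM 94 (1983), 2.10(b),
  Thm. 2.20, Thm. 4.9. [WarnerGTM94]
-/

noncomputable section

open scoped Manifold ContDiff ComplexConjugate Matrix Topology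
open Set Function Complex Literature.Geometry.Kaehler Literature.Geometry.GaugeTheory Literature.Topology.FourManifolds
open Literature.Geometry.Lorentzian (PseudoRiemannianMetric)
open Literature.Geometry.Manifold Literature.Geometry.Manifold.DeRhamSignFour Literature.NumberTheory.Transcendental

namespace Literature.Geometry.Symplectic

/-! ### Algebra: `sdCoeff ∘ sdMatrix`, top forms from one frame -/

/-- The self-dual coefficients of the self-dual part: `(Ω⁺)⁺ₖ = Ω⁺ₖ` for a 2-form matrix `Ω`
(`⋆` fixes the self-dual combinations `Ω₀₁ + Ω₂₃, …`). [cite: MorganSWBook1996, Lemma 2.3.4] -/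
theorem sdCoeff_sdMatrix {Ω : Matrix (Fin 4) (Fin 4) ℝ} (hΩ : IsTwoForm Ω) : sdCoeff (sdMatrix Ω) = sdCoeff Ω := by
  have h10 := hΩ.apply_swap 0 1
  have h20 := hΩ.apply_swap 0 2
  have h30 := hΩ.apply_swap 0 3
  have h21 := hΩ.apply_swap 1 2
  have h31 := hΩ.apply_swap 1 3
  have h32 := hΩ.apply_swap 2 3
  funext k
  fin_cases k <;>
    simp [sdCoeff, sdMatrix, hodgeStarTwo, Matrix.add_apply, Matrix.smul_apply, h10, h20, h30, h21, h31, h32] <;> ring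

/-- **A top-degree form on a `4`-dimensional space is determined by its value on one frame**
(linearly independent `e₀, …, e₃`): both sides are `sign σ` times that value on every permuted
frame, and vanish on non-injective index maps. [folklore] -/
theorem _root_.ContinuousAlternatingMap.eq_of_apply_frame_eq_four {V : Type*} [NormedAddCommGroup V] [NormedSpace ℝ V]
    [FiniteDimensional ℝ V] (hV : Module.finrank ℝ V = 4) {φ ψ : V [⋀^Fin 4]→L[ℝ] ℝ} {e : Fin 4 → V}
    (he : LinearIndependent ℝ e) (h : φ e = ψ e) : φ = ψ := by
  have hcard : Fintype.card (Fin 4) = Module.finrank ℝ V := by rw [Fintype.card_fin, hV]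
  apply ContinuousAlternatingMap.toAlternatingMap_injective
  refine (basisOfLinearIndependentOfCardEqFinrank he hcard).ext_alternating fun v hv ↦ ?_
  have hbij : Function.Bijective v := Finite.injective_iff_bijective.1 hv
  have hcoe : (fun i ↦ (basisOfLinearIndependentOfCardEqFinrank he hcard) (v i)) = e ∘ Equiv.ofBijective v hbij := by
    funext i
    simp [coe_basisOfLinearIndependentOfCardEqFinrank]
  rw [hcoe, AlternatingMap.map_perm, AlternatingMap.map_perm]
  simp only [ContinuousAlternatingMap.coe_toAlternatingMap, h]

/-- **`(a ∧ b)(v) = a(v₀, v₁) + a(v₂, v₃)` when `b = v⁰¹ + v²³` on the frame `v`** (the `(2,2)`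
shuffle formula, Warner 2.10(b), with `b₀₁ = b₂₃ = 1` and the other `b_{ab}` zero). [cite: WarnerGTM94, 2.10(b)] -/
theorem wedge_apply_of_frame_values {V : Type*} [NormedAddCommGroup V] [NormedSpace ℝ V]
    (a b : V [⋀^Fin 2]→L[ℝ] ℝ) (v : Fin 4 → V) (hb : ∀ i j, b ![v i, v j] = !![(0 : ℝ), 1, 0, 0; -1, 0, 0, 0; 0, 0, 0, 1; 0, 0, -1, 0] i j) :
    a.wedge b v = a ![v 0, v 1] + a ![v 2, v 3] := by
  rw [wedge_apply_two_two, hb 0 1, hb 0 2, hb 0 3, hb 1 2, hb 1 3, hb 2 3]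
  simp

namespace AlmostComplexStructure.IsCompatibleWith

variable {N : Type} [TopologicalSpace N] [ChartedSpace (EuclideanSpace ℝ (Fin 4)) N]
  [IsManifold (𝓡 4) ∞ N] {J : AlmostComplexStructure (𝓡 4) ∞ N} {s : MForm (𝓡 4) N ℝ 2}
  (h : J.IsCompatibleWith s) (hs : IsSmoothForm s)
  (hnd : ∀ x (v : TangentSpace (𝓡 4) x), v ≠ 0 → ∃ w : TangentSpace (𝓡 4) x, s x ![v, w] ≠ 0)

/-! ### Wedges against `s` in a unitary frame -/

/-- The values of `s` on the unitary frame of a chart of `𝔰_J`: `s₀₁ = s₂₃ = 1`, all other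
`s_{ab}` (`a < b`) vanish. [cite: Taubes1995, §5 Step 1 (p. 233)] -/
theorem symplectic_apply_frame (x₀ : N) {x : N} (hx : x ∈ (h.canonicalSpincStructure hs hnd).baseSet x₀) (a b : Fin 4) :
    s x ![(h.canonicalSpincStructure hs hnd).frame x₀ a x, (h.canonicalSpincStructure hs hnd).frame x₀ b x] =
      !![(0 : ℝ), 1, 0, 0; -1, 0, 0, 0; 0, 0, 0, 1; 0, 0, -1, 0] a b := by
  rw [← twoFormMatrix_apply s x (fun k ↦ (h.canonicalSpincStructure hs hnd).frame x₀ k x) a b,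
    h.twoFormMatrix_canonicalSpincStructure hs hnd x₀ hx]

/-- **`(θ ∧ s)(e₀, e₁, e₂, e₃) = θ(e₀, e₁) + θ(e₂, e₃) = θ⁺₀`** in every unitary frame of the canonical
`Spin^c` structure (`s = e⁰¹ + e²³`). [cite: WarnerGTM94, 2.10(b)] -/
theorem wedge_symplectic_apply_frame (θ : MForm (𝓡 4) N ℝ 2) (x₀ : N) {x : N}
    (hx : x ∈ (h.canonicalSpincStructure hs hnd).baseSet x₀) :
    (θ.wedge s) x (fun k ↦ (h.canonicalSpincStructure hs hnd).frame x₀ k x) =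
      θ x ![(h.canonicalSpincStructure hs hnd).frame x₀ 0 x, (h.canonicalSpincStructure hs hnd).frame x₀ 1 x] +
        θ x ![(h.canonicalSpincStructure hs hnd).frame x₀ 2 x, (h.canonicalSpincStructure hs hnd).frame x₀ 3 x] := by
  exact wedge_apply_of_frame_values (V := EuclideanSpace ℝ (Fin 4)) (θ x) (s x)
    (fun k ↦ (h.canonicalSpincStructure hs hnd).frame x₀ k x) (h.symplectic_apply_frame hs hnd x₀ hx)

/-- **`(s ∧ s)(e₀, e₁, e₂, e₃) = 2`** in every unitary frame of `𝔰_J` (`s ∧ s = 2 e⁰¹²³`).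
[cite: McDuffSalamon2017, §2.1 Cor. 2.1.4] -/
theorem wedge_self_symplectic_apply_frame (x₀ : N) {x : N} (hx : x ∈ (h.canonicalSpincStructure hs hnd).baseSet x₀) :
    (s.wedge s) x (fun k ↦ (h.canonicalSpincStructure hs hnd).frame x₀ k x) = 2 := by
  have hv := h.symplectic_apply_frame hs hnd x₀ hx
  rw [h.wedge_symplectic_apply_frame hs hnd s x₀ hx, hv 0 1, hv 2 3]
  simp
  norm_num

/-- **`θ ∧ s = ((θ₀₁ + θ₂₃)/2) · (s ∧ s)` for every 2-form `θ`** on the symplectic `4`-manifold, the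
coefficient read in the unitary frame of the chart `indexAt x` (both sides are top forms; compare
them on that frame). [cite: WarnerGTM94, 2.10(b)] -/
theorem wedge_symplectic_eq_smul_wedge_self (θ : MForm (𝓡 4) N ℝ 2) :
    θ.wedge s = (fun x ↦ (θ x ![(h.canonicalSpincStructure hs hnd).frame ((h.canonicalSpincStructure hs hnd).indexAt x) 0 x,
          (h.canonicalSpincStructure hs hnd).frame ((h.canonicalSpincStructure hs hnd).indexAt x) 1 x] +
        θ x ![(h.canonicalSpincStructure hs hnd).frame ((h.canonicalSpincStructure hs hnd).indexAt x) 2 x,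
          (h.canonicalSpincStructure hs hnd).frame ((h.canonicalSpincStructure hs hnd).indexAt x) 3 x]) / 2) •
      s.wedge s := by
  funext x
  have hi := (h.canonicalSpincStructure hs hnd).mem_baseSet_indexAt x
  have he := linearIndependent_of_isOrthonormalFrame _ ((h.canonicalSpincStructure hs hnd).isOrthonormalFrame_frame _ hi)
  refine ContinuousAlternatingMap.eq_of_apply_frame_eq_four (V := EuclideanSpace ℝ (Fin 4))
    (e := fun k ↦ (h.canonicalSpincStructure hs hnd).frame ((h.canonicalSpincStructure hs hnd).indexAt x) k x) (by simp) he ?_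
  change (θ.wedge s) x (fun k ↦ (h.canonicalSpincStructure hs hnd).frame ((h.canonicalSpincStructure hs hnd).indexAt x) k x) =
    (_ : ℝ) • (s.wedge s) x (fun k ↦ (h.canonicalSpincStructure hs hnd).frame ((h.canonicalSpincStructure hs hnd).indexAt x) k x)
  rw [h.wedge_symplectic_apply_frame hs hnd θ _ hi, h.wedge_self_symplectic_apply_frame hs hnd _ hi, smul_eq_mul]
  ring

/-! ### `∫_N (F_A - F_{A₀}) ∧ s = 0` -/

/-- **`(F_A - F_B) ∧ s` is an exact `4`-form** (`F_A - F_B = da`, `ds = 0`: `da ∧ s = d(a ∧ s)`).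
[cite: Taubes1994, §2 Lemma 4 (p. 815)] -/
theorem wedge_curvatureForm_sub_mem_exactSmoothForms [(h.metric hs).HasLeviCivita] (hcl : IsClosedForm s)
    (A B : (h.canonicalSpincStructure hs hnd).detLineBundle.Connection) :
    (((h.canonicalSpincStructure hs hnd).curvatureForm A - (h.canonicalSpincStructure hs hnd).curvatureForm B).wedge s).castDeg
        two_add_two_eq_four ∈ exactSmoothForms (𝓡 4) N ℝ 4 := by
  haveI := wedgeFacts_four (N := N)
  refine castDeg_mem_exactSmoothForms two_add_two_eq_four (wedge_mem_exactSmoothForms_of_left ?_ ⟨hs, hcl⟩)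
  rw [(h.canonicalSpincStructure hs hnd).curvatureForm_sub_eq_mextDeriv A B]
  change mextDeriv ((h.canonicalSpincStructure hs hnd).connectionDiff A B).toMForm ∈
    Submodule.span ℝ (mextDeriv '' (smoothForms (𝓡 4) N ℝ 1 : Set (MForm (𝓡 4) N ℝ 1)))
  exact Submodule.subset_span ⟨_, (h.canonicalSpincStructure hs hnd).isSmoothForm_toMForm_connectionDiff A B, rfl⟩

/-- **`∫_N (F_A - F_B) ∧ s = 0`** on the closed symplectic `4`-manifold, for any two unitary
connections on `det P̃` of `𝔰_J` (Stokes; the orientation is that of the volume form `s ∧ s`).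
[cite: Taubes1994, §2 Lemma 4 (p. 815)] -/
theorem integral_wedge_curvatureForm_sub_eq_zero [T2Space N] [CompactSpace N] [(h.metric hs).HasLeviCivita]
    (hcl : IsClosedForm s) (A B : (h.canonicalSpincStructure hs hnd).detLineBundle.Connection) :
    MForm.integral (rayFamily (wedge_self_castDeg_apply_ne_zero s hnd))
      ((((h.canonicalSpincStructure hs hnd).curvatureForm A - (h.canonicalSpincStructure hs hnd).curvatureForm B).wedge s).castDeg
        two_add_two_eq_four) = 0 :=
  MForm.integral_eq_zero_of_mem_exactSmoothForms_holds _
    (isContinuousOrientation_rayFamily (wedge_self_castDeg_mem_closedSmoothForms ⟨hs, hcl⟩).1 _)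
    (h.wedge_curvatureForm_sub_mem_exactSmoothForms hs hnd hcl A B)

/-! ### The integrated `ω`-component -/

/-- **The `ω`-coefficient of `F_A - F_{A₀}` for a solution of the family**: with `A₀` Taubes's
connection and `(A, ψ)` a solution of `(SW_η)`, `η = P₊F_{A₀} - (|c|²/4)s`, in the unitary frame `e`
of the chart `indexAt x`,
`(F_A - F_{A₀})(e₀, e₁) + (F_A - F_{A₀})(e₂, e₃) = (|ψ₁|² - |ψ₀|² - |c|²)/2`
(`TaubesFamilyCurvatureComponents` with `(P₊F_{A₀})⁺₀ = (F_{A₀})⁺₀`). [cite: Taubes1994, §2 (6)] -/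
theorem curvatureForm_sub_frame_sum_eq [(h.metric hs).HasLeviCivita] (c : ℂ)
    {cfg : (h.canonicalSpincStructure hs hnd).Configuration}
    (hsol : SpincStructure.IsSolution (h.taubesPerturbation hs hnd - h.symplecticPerturbation hs hnd (Complex.normSq c / 4)) cfg)
    (x : N) :
    ((h.canonicalSpincStructure hs hnd).curvatureForm cfg.conn -
          (h.canonicalSpincStructure hs hnd).curvatureForm (h.taubesConnection hs hnd)) x
        ![(h.canonicalSpincStructure hs hnd).frame ((h.canonicalSpincStructure hs hnd).indexAt x) 0 x,
          (h.canonicalSpincStructure hs hnd).frame ((h.canonicalSpincStructure hs hnd).indexAt x) 1 x] +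
      ((h.canonicalSpincStructure hs hnd).curvatureForm cfg.conn -
          (h.canonicalSpincStructure hs hnd).curvatureForm (h.taubesConnection hs hnd)) x
        ![(h.canonicalSpincStructure hs hnd).frame ((h.canonicalSpincStructure hs hnd).indexAt x) 2 x,
          (h.canonicalSpincStructure hs hnd).frame ((h.canonicalSpincStructure hs hnd).indexAt x) 3 x] =
      (Complex.normSq (cfg.plusSpinor ((h.canonicalSpincStructure hs hnd).indexAt x) x 1) -
        Complex.normSq (cfg.plusSpinor ((h.canonicalSpincStructure hs hnd).indexAt x) x 0) - Complex.normSq c) / 2 := by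
  have hi := (h.canonicalSpincStructure hs hnd).mem_baseSet_indexAt x
  have hB := h.sdCoeff_zero_curvature_eq_of_isSolution hs hnd (h.taubesPerturbation hs hnd) c hsol _ hi
  rw [taubesPerturbation_form, (h.canonicalSpincStructure hs hnd).twoFormMatrix_sdCurvatureForm _ _ hi,
    sdCoeff_sdMatrix ((h.canonicalSpincStructure hs hnd).isTwoForm_curvatureMatrix _ _ _)] at hB
  rw [← hB]
  simp only [Pi.sub_apply, ContinuousAlternatingMap.sub_apply,
    (h.canonicalSpincStructure hs hnd).curvatureForm_eq cfg.conn _ hi,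
    (h.canonicalSpincStructure hs hnd).curvatureForm_eq (h.taubesConnection hs hnd) _ hi,
    SpincStructure.curvForm_apply, sdCoeff, SpincStructure.curvatureMatrix_apply, Matrix.cons_val_zero]
  ring

/-- **Taubes's integrated `ω`-component: `∫_N (|ψ₁|² - |ψ₀|² - |c|²) s ∧ s = 0`**, i.e.
`r ∫_N (1 - |α|² + |β|²) ω ∧ ω = 0` in the scaling `ψ = √r(α u₀ + β)`, `r = |c|²`.  On a closed
symplectic `4`-manifold `(N, s)` with compatible `J`, for Taubes's connection `A₀` on `K⁻¹` and every
(smooth) solution `(A, ψ)` of the Seiberg–Witten equations with perturbation `P₊F_{A₀} - (|c|²/4)·s`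
(the family (5.2) of Taubes 1995), the function `|ψ₁|² - |ψ₀|² - |c|²` (`ψ₁` the component along
`u₀`, `ψ₀` along `K⁻¹`, read at each `x` in the chart `indexAt x`) integrates to zero against the
volume form `s ∧ s` (orientation of `s ∧ s`): `(F_A - F_{A₀}) ∧ s = ((|ψ₁|² - |ψ₀|² - |c|²)/4)·s ∧ s`
pointwise by the `ω`-component of the curvature equation, and `∫_N (F_A - F_{A₀}) ∧ s = 0` since
`F_A - F_{A₀} = da` is exact and `ds = 0` (Taubes 1994, Lemma 4 and §3 Step 1, (19)–(20)).
[cite: Taubes1994, §3 Step 1 (19)–(20) (p. 816)] -/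
theorem integral_normSq_sub_smul_wedge_self_eq_zero [T2Space N] [CompactSpace N] [(h.metric hs).HasLeviCivita]
    (hcl : IsClosedForm s) (c : ℂ) {cfg : (h.canonicalSpincStructure hs hnd).Configuration}
    (hsol : SpincStructure.IsSolution (h.taubesPerturbation hs hnd - h.symplecticPerturbation hs hnd (Complex.normSq c / 4)) cfg) :
    MForm.integral (rayFamily (wedge_self_castDeg_apply_ne_zero s hnd))
      ((fun x ↦ Complex.normSq (cfg.plusSpinor ((h.canonicalSpincStructure hs hnd).indexAt x) x 1) -
          Complex.normSq (cfg.plusSpinor ((h.canonicalSpincStructure hs hnd).indexAt x) x 0) - Complex.normSq c) •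
        (s.wedge s).castDeg two_add_two_eq_four) = 0 := by
  have hint := h.integral_wedge_curvatureForm_sub_eq_zero hs hnd hcl cfg.conn (h.taubesConnection hs hnd)
  have hθ := h.wedge_symplectic_eq_smul_wedge_self hs hnd
    ((h.canonicalSpincStructure hs hnd).curvatureForm cfg.conn -
      (h.canonicalSpincStructure hs hnd).curvatureForm (h.taubesConnection hs hnd))
  have hcoef : (fun x ↦ (((h.canonicalSpincStructure hs hnd).curvatureForm cfg.conn -
          (h.canonicalSpincStructure hs hnd).curvatureForm (h.taubesConnection hs hnd)) x
        ![(h.canonicalSpincStructure hs hnd).frame ((h.canonicalSpincStructure hs hnd).indexAt x) 0 x,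
          (h.canonicalSpincStructure hs hnd).frame ((h.canonicalSpincStructure hs hnd).indexAt x) 1 x] +
      ((h.canonicalSpincStructure hs hnd).curvatureForm cfg.conn -
          (h.canonicalSpincStructure hs hnd).curvatureForm (h.taubesConnection hs hnd)) x
        ![(h.canonicalSpincStructure hs hnd).frame ((h.canonicalSpincStructure hs hnd).indexAt x) 2 x,
          (h.canonicalSpincStructure hs hnd).frame ((h.canonicalSpincStructure hs hnd).indexAt x) 3 x]) / 2) =
      fun x ↦ (4⁻¹ : ℝ) * (Complex.normSq (cfg.plusSpinor ((h.canonicalSpincStructure hs hnd).indexAt x) x 1) -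
          Complex.normSq (cfg.plusSpinor ((h.canonicalSpincStructure hs hnd).indexAt x) x 0) - Complex.normSq c) := by
    funext x
    rw [h.curvatureForm_sub_frame_sum_eq hs hnd c hsol x]
    ring
  rw [hθ, hcoef] at hint
  have hsmul : ((fun x ↦ (4⁻¹ : ℝ) * (Complex.normSq (cfg.plusSpinor ((h.canonicalSpincStructure hs hnd).indexAt x) x 1) -
          Complex.normSq (cfg.plusSpinor ((h.canonicalSpincStructure hs hnd).indexAt x) x 0) - Complex.normSq c)) •
        s.wedge s).castDeg two_add_two_eq_four =
      (4⁻¹ : ℝ) • ((fun x ↦ Complex.normSq (cfg.plusSpinor ((h.canonicalSpincStructure hs hnd).indexAt x) x 1) -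
          Complex.normSq (cfg.plusSpinor ((h.canonicalSpincStructure hs hnd).indexAt x) x 0) - Complex.normSq c) •
        (s.wedge s).castDeg two_add_two_eq_four) := by
    funext x
    ext w
    simp [mul_assoc]
  rw [hsmul, MForm.integral_smul] at hint
  simpa using hint

end AlmostComplexStructure.IsCompatibleWith

end Literature.Geometry.Symplectic

end
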